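import Mathlib
import Literature.Computability.AlgebraicComplexity.ASSS16DerivativeAlgebra
import Literature.Computability.AlgebraicComplexity.FSV18Lemma53Reduction
import HarnessLib

/-!
# [ASSS16] §4, bottom of the recursion: Jacobian minors of derivatives of sparse leaves are sparse
# — proofs only (N1 occur push, plan step F4, bottom level)

M. Agrawal, C. Saha, R. Saptharishi, N. Saxena, arXiv:1111.0582 [AgrawalEtAl2011], §4, proof of
Theorem `thm:dDkrPIT` (p0010:L49–L58): "Unfolding the recursion, we eventually reach the level of the
sparse polynomials … Let `𝒰 ∈ 𝒞_{D-2}` with transcendence basis `𝒰'`. Any `|𝒰'| × |𝒰'|` minor of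
`𝒥_x(𝒰')` is a sparse polynomial with sparsity bounded by `s^R` and degree bounded by `sR`." In the
cell's rendering of FSV Thm. 48 / Construction 46 the bottom map is an ABSTRACT `Φ` that hits every
polynomial of sparsity `≤ R!·s^R` (`FSV2018_thm48`, `FSV2018_thm48_topFanIn`); this file proves that
such a `Φ` keeps every such minor nonzero:

* `ASSS16.card_support_iterPderiv_le` — `Δ_β` does not increase the number of monomials
  (`iterPderiv_monomial`: `Δ_β (a x^s) = (a·w) x^{s-β}`);
* `ASSS16.card_support_det_jacobian_iterPderiv_le` — an `r × r` Jacobian minor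
  `det(∂_{x_v} Δ_{β_u} p_u)` of derivatives of polynomials with `≤ s` monomials has `≤ r!·s^r`
  monomials (the determinant count `mvPolynomial_card_support_det_le` of `FSV18Lemma53Reduction`);
* `ASSS16.factorial_mul_pow_mono` — `r!·s^r ≤ R!·s^R` for `r ≤ R`, `1 ≤ s`;
* `ASSS16.card_support_le_leafSize` — a leaf of an occur formula has at most FSV-size many
  monomials (`Σ_m (deg m + 1)`, Def. 45), so "`≤ s`" holds for the leaves of a size-`s` formula;
* `ASSS16.bind₁_det_jacobian_iterPderiv_ne_zero` — hence a hitting-set generator for sparsity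
  `≤ R!·s^R` keeps every nonzero such minor nonzero.

No definitions, no named facts. Honest framing: bookkeeping; nothing here bears on `VP ≠ VNP`.

## References
* [AgrawalEtAl2011] arXiv:1111.0582 §4, proof of Thm. dDkrPIT (locator: paper:arxiv-1111.0582
  p0010.txt:L49–L58).
* [ForbesShpilkaVolk2018] Construction 46 / Thm. 48 (seq.; = ToC Constr. 5.22 / Thm. 5.24) — the
  abstract sparse-hitting `Φ`.
-/

noncomputable section

namespace Literature.Computability.AlgebraicComplexity

namespace ASSS16

open MvPolynomial Finset Literature.Barriers.ValiantsHypothesis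

open scoped BigOperators

open Literature.RepresentationTheory.AlgebraicGroups (iterPderiv iterPderiv_monomial)

variable {F : Type*} [Field F] {σ : Type*}

/-- **`Δ_β` does not increase sparsity:** `|supp Δ_β p| ≤ |supp p|` (each monomial `x^s` goes to a
multiple of `x^{s-β}`). [cite: AgrawalEtAl2011, §4, proof of Thm. dDkrPIT ("a sparse polynomial with sparsity bounded by `s^R`")]
locator: paper:arxiv-1111.0582 p0010.txt:L53–L55 -/
theorem card_support_iterPderiv_le [DecidableEq σ] (β : σ →₀ ℕ) (p : MvPolynomial σ F) :
    (iterPderiv (A := F) β p).support.card ≤ p.support.card := by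
  classical
  have hsum : iterPderiv (A := F) β p =
      ∑ s ∈ p.support, monomial (s - β) (coeff s p * (Literature.RepresentationTheory.AlgebraicGroups.iterPderivWeight β s : F)) := by
    conv_lhs => rw [p.as_sum]
    rw [map_sum]
    exact Finset.sum_congr rfl fun s _ => iterPderiv_monomial β s _
  have hsub : (iterPderiv (A := F) β p).support ⊆ p.support.image fun s => s - β := by
    rw [hsum]
    intro m hm
    obtain ⟨s, hs, hms⟩ := Finset.mem_biUnion.mp (support_sum hm)
    rw [Finset.mem_image]
    refine ⟨s, hs, ?_⟩
    by_contra hne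
    rw [support_monomial] at hms
    split_ifs at hms with h0
    · exact absurd hms (Finset.notMem_empty _)
    · exact hne (Finset.mem_singleton.mp hms).symm
  exact (Finset.card_le_card hsub).trans Finset.card_image_le

/-- **The bottom-level minors are sparse:** an `r × r` Jacobian minor `det(∂_{x_v} Δ_{β_u} p_u)` of
derivatives of polynomials with at most `s` monomials each has at most `r!·s^r` monomials ("Any
`|𝒰'| × |𝒰'|` minor of `𝒥_x(𝒰')` is a sparse polynomial with sparsity bounded by `s^R`"; FSV's
rendering books `R!·s^R`). [cite: AgrawalEtAl2011, §4, proof of Thm. dDkrPIT; ForbesShpilkaVolk2018, Thm. 48 (seq.) = ToC Thm. 5.24 (sparsity `R!·s^R`)]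
locator: paper:arxiv-1111.0582 p0010.txt:L53–L55 -/
theorem card_support_det_jacobian_iterPderiv_le [DecidableEq σ] {r s : ℕ}
    (p : Fin r → MvPolynomial σ F) (β : Fin r → σ →₀ ℕ) (x : Fin r → σ)
    (hp : ∀ u, (p u).support.card ≤ s) :
    (Matrix.of fun u v => pderiv (x v) (iterPderiv (A := F) (β u) (p u))).det.support.card ≤
      r.factorial * s ^ r := by
  refine mvPolynomial_card_support_det_le _ fun u v => ?_
  rw [Matrix.of_apply, pderiv_iterPderiv]
  exact (card_support_iterPderiv_le _ _).trans (hp u)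

/-- `r!·s^r ≤ R!·s^R` for `r ≤ R` and `1 ≤ s` (fewer derivatives, same budget).
[cite: AgrawalEtAl2011, §4, proof of Thm. dDkrPIT ("each set containing at most `r_{D-2}` elements … bound `r_{D-2}` by `R`")]
locator: paper:arxiv-1111.0582 p0010.txt:L49–L52 -/
theorem factorial_mul_pow_mono {r R s : ℕ} (hr : r ≤ R) (hs : 1 ≤ s) :
    r.factorial * s ^ r ≤ R.factorial * s ^ R :=
  Nat.mul_le_mul (Nat.factorial_le hr) (Nat.pow_le_pow_right hs hr)

/-- **A leaf has at most FSV-size many monomials:** `|supp p| ≤ Σ_{m ∈ supp p} (deg m + 1)` (Def. 45: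
"the size of a leaf node is the size of the depth-2 formula it is computing", one wire per monomial
at least). [cite: ForbesShpilkaVolk2018, Def. 45 (seq.) = ToC Def. 5.21 (size of a leaf)]
locator: paper:arxiv-1701.05328 p0020.txt:L65 -/
theorem card_support_le_leafSize (p : MvPolynomial σ F) :
    p.support.card ≤ ∑ m ∈ p.support, (m.degree + 1) := by
  rw [Finset.card_eq_sum_ones]
  exact Finset.sum_le_sum fun m _ => Nat.le_add_left 1 _

/-- **The abstract sparse-hitting map keeps the bottom-level minors nonzero:** if `Φ` is a hitting-set
generator for the polynomials with at most `R!·s^R` monomials, `r ≤ R`, `1 ≤ s`, and the leaves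
`p_u` have at most `s` monomials, then every NONZERO minor `det(∂_{x_v} Δ_{β_u} p_u)` stays nonzero
under `Φ` ("one of the maps `Φ_p` … preserves the rank of the Jacobian of all `𝒰` in `𝒞_{D-2}`").
[cite: AgrawalEtAl2011, §4, proof of Thm. dDkrPIT; ForbesShpilkaVolk2018, Thm. 48 (seq.) = ToC Thm. 5.24 (the map `Φ`)]
locator: paper:arxiv-1111.0582 p0010.txt:L55–L60 -/
theorem bind₁_det_jacobian_iterPderiv_ne_zero [DecidableEq σ] {τ : Type*} {r R s : ℕ}
    {M : Set (σ →₀ ℕ)} (Φ : M → MvPolynomial τ F)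
    (hΦ : IsHittingSetGenerator {P : MvPolynomial M F | P.support.card ≤ R.factorial * s ^ R} Φ)
    (hr : r ≤ R) (hs : 1 ≤ s) (p : Fin r → MvPolynomial M F) (β : Fin r → M →₀ ℕ) (x : Fin r → M)
    (hp : ∀ u, (p u).support.card ≤ s)
    (hdet : (Matrix.of fun u v => pderiv (x v) (iterPderiv (A := F) (β u) (p u))).det ≠ 0) :
    MvPolynomial.bind₁ Φ
      (Matrix.of fun u v => pderiv (x v) (iterPderiv (A := F) (β u) (p u))).det ≠ 0 := by
  classical
  refine hΦ _ ?_ hdet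
  exact (card_support_det_jacobian_iterPderiv_le p β x hp).trans (factorial_mul_pow_mono hr hs)

/-! ### `trdeg ≤` the size of the family (the `r` fed to Lemma 2.2 / FSV Lemma 52 at each level) -/

/-- A family indexed by a finite type has transcendence degree at most its cardinality (every
algebraically independent subfamily is a subfamily): the cell's `TrdegLE`. Used with the level
families of `≤ r_ℓ` derivatives ("a set of `r_ℓ` derivatives … `𝒰'` a transcendence basis",
so `|𝒰'| ≤ r_ℓ`). [cite: AgrawalEtAl2011, Lemma 4.2 (= lem:descent-jacobian), statement]
locator: paper:arxiv-1111.0582 p0010.txt:L12–L15 -/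
theorem trdegLE_card {ι κ : Type*} [Fintype κ] (U : κ → MvPolynomial ι F) :
    TrdegLE F U (Fintype.card κ) :=
  fun S _ => Finset.card_le_univ S

/-- `TrdegLE` is monotone in the bound. [cite: AgrawalEtAl2011, Lemma 2.2 ("trdeg `≤ r`")]
locator: paper:arxiv-1111.0582 p0006.txt:L45–L48 -/
theorem trdegLE_mono {ι κ : Type*} {U : κ → MvPolynomial ι F} {r r' : ℕ} (h : TrdegLE F U r)
    (hr : r ≤ r') : TrdegLE F U r' :=
  fun S hS => (h S hS).trans hr

/-- Hence a family `U : Fin m → …` with `m ≤ r` has `TrdegLE F U r`.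
[cite: AgrawalEtAl2011, Lemma 4.2 (= lem:descent-jacobian) with Lemma 2.2] locator: paper:arxiv-1111.0582 p0010.txt:L12–L15 -/
theorem trdegLE_fin_of_le {ι : Type*} {m r : ℕ} (U : Fin m → MvPolynomial ι F) (hm : m ≤ r) :
    TrdegLE F U r :=
  trdegLE_mono (by simpa using trdegLE_card (F := F) U) hm

/-! ### The full generator (Vandermonde blocks ⊕ `Φ`) hits whatever `Φ` hits: specialise the
### block variables to `0` ("lift this map `Ψ_{D-2}` to `Ψ_2`", p0010:L56–L58) -/

/-- **Specialisation principle:** if an algebra map `S` carries the generator `G` onto `Φ`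
coordinatewise, then `G` hits every polynomial `Φ` hits (`S (P(G)) = P(Φ) ≠ 0`).
[cite: AgrawalEtAl2011, §4 (Thm. dDkrPIT, proof: "lift this map `Ψ_{D-2}` to `Ψ_2`")]
locator: paper:arxiv-1111.0582 p0010.txt:L56–L58 -/
theorem bind₁_ne_zero_of_algHom_comp_eq {M σ₁ σ₂ : Type*} (P : MvPolynomial M F)
    (Φ : M → MvPolynomial σ₂ F) (G : M → MvPolynomial σ₁ F)
    (S : MvPolynomial σ₁ F →ₐ[F] MvPolynomial σ₂ F) (hG : ∀ m, S (G m) = Φ m)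
    (hP : MvPolynomial.bind₁ Φ P ≠ 0) : MvPolynomial.bind₁ G P ≠ 0 := by
  intro h0
  apply hP
  have h1 : S (MvPolynomial.bind₁ G P) = MvPolynomial.bind₁ Φ P := by
    rw [← MvPolynomial.aeval_eq_bind₁, ← MvPolynomial.aeval_eq_bind₁,
      show S (aeval G P) = (S.comp (aeval G)) P from rfl, comp_aeval]
    exact congrArg (fun f => aeval f P) (funext hG)
  rw [← h1, h0, map_zero]

/-- **The layered generator of `FSV2018_thm48_topFanIn` (any sub-family `L` of its Vandermonde
blocks, plus `Φ` on fresh variables) hits every polynomial that `Φ` alone hits** — setting all block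
variables `y_{j,ℓ}, t_ℓ` to `0` kills the blocks (`vdmGenCoeff` has no constant term) and leaves
`Φ`. Used at the bottom of the recursion (the minors of leaf derivatives are hit by `Φ`, hence by
every tail `Ψ_ℓ ⊇ Φ` of the generator) and wherever a leaf persists above the bottom level.
[cite: AgrawalEtAl2011, §4 (Thm. dDkrPIT, proof); ForbesShpilkaVolk2018, Construction 46 / Thm. 48 (seq.) = ToC Constr. 5.22 / Thm. 5.24 (the block layout)]
locator: paper:arxiv-1111.0582 p0010.txt:L49–L58 -/
theorem bind₁_vdmBlocks_add_rename_ne_zero {n D' R : ℕ} {τ : Type*}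
    (Φ : multilinearMonomials n → MvPolynomial τ F) (L : Finset (Fin D'))
    (r : Fin D' → Fin (R + 1)) {P : MvPolynomial (multilinearMonomials n) F}
    (hP : MvPolynomial.bind₁ Φ P ≠ 0) :
    MvPolynomial.bind₁ (fun m : multilinearMonomials n =>
      (∑ ℓ ∈ L,
        rename (fun v : Fin (r ℓ) ⊕ Unit =>
            (Sum.inl (ℓ, Sum.map (Fin.castLE (Nat.lt_succ_iff.mp (r ℓ).isLt)) id v) :
              (Fin D' × (Fin R ⊕ Unit)) ⊕ τ))
          (vdmGenCoeff F n (r ℓ) (m : Fin n →₀ ℕ))) +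
        rename Sum.inr (Φ m)) P ≠ 0 := by
  classical
  -- the specialisation: block variables ↦ 0, the `τ`-variables kept
  let S : MvPolynomial ((Fin D' × (Fin R ⊕ Unit)) ⊕ τ) F →ₐ[F] MvPolynomial τ F :=
    aeval (Sum.elim (fun _ => 0) X)
  refine bind₁_ne_zero_of_algHom_comp_eq P Φ _ S (fun m => ?_) hP
  have hblock : ∀ ℓ ∈ L, S (rename (fun v : Fin (r ℓ) ⊕ Unit =>
      (Sum.inl (ℓ, Sum.map (Fin.castLE (Nat.lt_succ_iff.mp (r ℓ).isLt)) id v) :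
        (Fin D' × (Fin R ⊕ Unit)) ⊕ τ)) (vdmGenCoeff F n (r ℓ) (m : Fin n →₀ ℕ))) = 0 := by
    intro ℓ _
    simp only [S, aeval_rename, vdmGenCoeff, map_sum, map_mul, map_pow, aeval_X,
      Function.comp_apply, Sum.elim_inl, zero_mul, Finset.sum_const_zero]
  have htail : S (rename Sum.inr (Φ m)) = Φ m := by
    simp only [S, aeval_rename]
    have : (Sum.elim (fun _ : Fin D' × (Fin R ⊕ Unit) => (0 : MvPolynomial τ F)) X) ∘ Sum.inr =
        (X : τ → MvPolynomial τ F) := by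
      funext i; rfl
    rw [this, aeval_X_left_apply]
  rw [map_add, map_sum, Finset.sum_eq_zero hblock, zero_add, htail]

end ASSS16

end Literature.Computability.AlgebraicComplexity
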